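import Literature.NumberTheory.GaloisRepresentations.WeilLAdicCharacterProofs
import Literature.NumberTheory.GaloisRepresentations.PstWeilDeligne
import Literature.NumberTheory.PAdicHodge.FontaineDpst
import HarnessLib

/-!
# The `ℓ`-adic character of an algebraic Hecke character is de Rham above `ℓ` (Serre 1968; named fact)

Topic `NumberTheory/GaloisRepresentations`; namespace `Literature.NumberTheory.GaloisRepresentations`.
Companion of the PROVED `HeckeCharacter.IsAlgebraic.exists_lAdic` (Weil 1956: the `ℓ`-adic character
`r = χ_{ℓ,ι}` of an algebraic Hecke character `χ`, unramified with the right Frobenius at `v ∤ ℓ` where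
`χ` is unramified).  Weil's construction (Serre, *Abelian ℓ-adic representations*, Ch. II §2.4–2.8)
gives more: `r` is LOCALLY ALGEBRAIC at the places above `ℓ` (Serre, Ch. III §2.3, Prop. and §3), and a
locally algebraic abelian `ℓ`-adic representation of a local field is Hodge–Tate (Tate; Serre Ch. III
App. A2–A5) and indeed de Rham (for a character: de Rham ⟺ Hodge–Tate ⟺ `ψ ∘ Art_F = ∏_τ τ^{-n_τ}` on
an open subgroup of `𝒪_F^×`, B. Conrad, *Lifting global representations with local properties* (2011),
App. B, Prop. B.4).  ONE named fact (D-0014), in the existence form that users of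
`IsAlgebraic.exists_lAdic` consume: the same clauses PLUS "de Rham at every `v ∣ ℓ` for Fontaine's
pinned datum `PAdicHodge.fontainePstAdicCompletion v ℓ hv`" (the clause of `Pan2022_proModularDeRhamClassical_GL2Q`).
By rank-one rigidity (Chebotarev: a continuous character is determined by its Frobenius values off a
finite set) the `r` here is Weil's `r`, so the fact says exactly "`χ_{ℓ,ι}` is de Rham above `ℓ`".

Consumer: crux `PicardMuOrdinary.IrregularClassicality` (stmt-Langlands-13758), line
`slope-free-polarized-limit`, registered stub `stub_weilLAdicCharacterDeRham` (= this fact at `K = ℚ(ω)`,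
`ℓ = 3`): the geometric de Rham input `ρ_C ⊗ ψ` of the honest classicality heart.

What is NOT here: a proof (needs the `p`-adic Hodge theory of Lubin–Tate / CM characters — `B_dR`
contains the periods of `τ ∘ Art_F⁻¹` —, absent from the tree: see the TODO in
`PstWeilDeligneCrystallineDetOnInertia`); the Hodge–Tate weights of `r` (they are `-n_τ` in the
tree's convention `HT(ε) = -1`); crystallinity at `v ∣ ℓ` unramified for `χ`.

References: A. Weil, *On a certain type of characters…* (1956) §1 [Weil1956]; J.-P. Serre, *Abelian
ℓ-adic representations and elliptic curves* (1968), Ch. II §2.4–2.8, Ch. III §2.3, §3, App. A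
[SerreAbelianLadic1968]; B. Conrad, *Lifting global representations with local properties* (2011),
App. B Prop. B.4 [Conrad2011LiftingGlobal]; J.-M. Fontaine, Astérisque 223, Exp. III [FontaineAsterisque223III].
-/

noncomputable section

open scoped NumberField Polynomial
open NumberField IsDedekindDomain Field Polynomial

namespace Literature.NumberTheory.GaloisRepresentations

/-- **Serre 1968 (with Weil 1956, Tate, Conrad App. B): the `ℓ`-adic character of an algebraic Hecke
character is de Rham at the places above `ℓ`** (named fact, existence form).  For every number field
`K`, prime `ℓ`, algebraic Hecke character `χ` of `K` and field isomorphism `ι : ℚ̄_ℓ ≃+* ℂ` there is a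
continuous `r : Γ_K → GL₁(ℚ̄_ℓ)` which (i) at every finite `v ∤ ℓ` where `χ` is unramified is
unramified with arithmetic-Frobenius characteristic polynomial `X - ι⁻¹(χ(ϖ_v))⁻¹` — VERBATIM the
conclusion of the proved `HeckeCharacter.IsAlgebraic.exists_lAdic` — and (ii) is de Rham at every
`v ∣ ℓ` for Fontaine's pinned datum (`PstWeilDeligneData.IsDeRhamFramed`).  (i) pins `r` (Chebotarev,
rank one), so (ii) is a property of Weil's `χ_{ℓ,ι}`: Serre Ch. III §2.3 (locally algebraic) + App. A /
Conrad Prop. B.4 (locally algebraic ⟹ Hodge–Tate ⟺ de Rham for characters).  Users take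
`(h : HeckeCharacter.exists_lAdic_isDeRhamFramed)`.
[cite: SerreAbelianLadic1968, Ch. III §2.3 and App. A2–A5 (with Ch. II §2.4–2.8)]
[cite: Conrad2011LiftingGlobal, App. B, Prop. B.4] [cite: Weil1956, §1] -/
def HeckeCharacter.exists_lAdic_isDeRhamFramed : Prop :=
  ∀ (K : Type) [Field K] [NumberField K] (ℓ : ℕ) [Fact ℓ.Prime] (χ : HeckeCharacter K),
    χ.IsAlgebraic → ∀ (ι : PadicAlgCl ℓ ≃+* ℂ),
      ∃ r : FramedGaloisRep K (PadicAlgCl ℓ) 1,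
        (∀ v : HeightOneSpectrum (𝓞 K), ((ℓ : ℕ) : 𝓞 K) ∉ v.asIdeal → χ.IsUnramifiedAt v →
          r.IsUnramifiedAt v ∧ r.HasFrobCharpolyAt v (X - C (ι.symm (χ.valueAtUniformizer v)⁻¹))) ∧
        ∀ (v : HeightOneSpectrum (𝓞 K)) (hv : ((ℓ : ℕ) : 𝓞 K) ∈ v.asIdeal),
          (PAdicHodge.fontainePstAdicCompletion v ℓ hv).IsDeRhamFramed (r.toLocal v)

/-- The fact refines Weil's proved existence theorem: dropping clause (ii) gives back (the statement
of) `HeckeCharacter.IsAlgebraic.exists_lAdic`. [folklore] -/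
theorem HeckeCharacter.exists_lAdic_of_exists_lAdic_isDeRhamFramed
    (h : HeckeCharacter.exists_lAdic_isDeRhamFramed) {K : Type} [Field K] [NumberField K]
    {ℓ : ℕ} [Fact ℓ.Prime] {χ : HeckeCharacter K} (hχ : χ.IsAlgebraic) (ι : PadicAlgCl ℓ ≃+* ℂ) :
    ∃ r : FramedGaloisRep K (PadicAlgCl ℓ) 1, ∀ v : HeightOneSpectrum (𝓞 K), ((ℓ : ℕ) : 𝓞 K) ∉ v.asIdeal →
      χ.IsUnramifiedAt v →
        r.IsUnramifiedAt v ∧ r.HasFrobCharpolyAt v (X - C (ι.symm (χ.valueAtUniformizer v)⁻¹)) := by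
  obtain ⟨r, hr, -⟩ := h K ℓ χ hχ ι
  exact ⟨r, hr⟩

end Literature.NumberTheory.GaloisRepresentations

end
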